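/-
Copyright (c) 2026. All rights reserved.
Released under Apache 2.0 license as described in the file LICENSE.
Authors: abc-iut cell, prover seat abc-iut-L4-d1 (gen 9; row «COMPACT-HYP⇒NONAB», F4b: an ABELIAN torsion-free
Fuchsian group admits a bounded, invariant, non-constant holomorphic function on `ℍ`).
-/
import Literature.AnabelianGeometry.AbsoluteAnabelian.ArchimedeanHolFieldFunctorGeometricPSLAxisFunction
import HarnessLib

/-!
# An abelian torsion-free Fuchsian group admits a bounded invariant non-constant holomorphic function
# (PROOF-ONLY)

Classical input for S. Mochizuki, *Topics in Absolute Anabelian Geometry III*, Cor. 2.4 p.54 / Prop. 4.2 (i)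
p.106 («`X` a HYPERBOLIC Riemann surface of finite type», uniformised as `ℍ/Λ̄`): H. M. Farkas, I. Kra,
*Riemann Surfaces* (1992), IV.6 — an ABELIAN torsion-free Fuchsian group `Λ̄` is cyclic, generated by a
parabolic or a hyperbolic element, and `ℍ/Λ̄` is `ℍ`, a punctured disc or an annulus; in each case `ℍ/Λ̄`
carries a non-constant bounded holomorphic function (the cusp coordinate `e^{2πiτ/x}`, resp. the annulus
coordinate `τ^{2πi/ℓ}`).  Typed without naming the quotient: for `Λ̄ ≤ PSL₂(ℝ)` acting on `ℍ` properly
discontinuously (`ProperlyDiscontinuousSMul`) and, where needed, freely (`IsCancelSMul`):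

* §1 `HolRS.exists_invariant_of_translSL_mem` — if `Λ̄` contains a parabolic `π(A T_h A⁻¹)`, `h ≠ 0`,
  central in `Λ̄`, then the translation lengths of `Λ̄` at the cusp `A • ∞` form a CYCLIC subgroup of `ℝ`
  (`…PSLAxisFunction`'s `exists_eq_closure_of_smul_curve`) and the cusp function of the generator
  (`…PSLCuspFunction`'s `exists_cuspFunction`) is `Λ̄`-invariant;
* §2 `HolRS.exists_invariant_of_diag_mem` — the same for a central hyperbolic `π(g D g⁻¹)`, `D = diag(l, l⁻¹)`,
  `l² ≠ 1`: the logarithmic dilation factors along the axis `g • iℝ₊` form a cyclic subgroup of `ℝ` and the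
  axis function of the generator (`exists_axisFunction`) is `Λ̄`-invariant;
* §3 ★ `HolRS.exists_invariant_holomorphic_of_comm` — **for `Λ̄ ≤ PSL₂(ℝ)` ABELIAN, acting freely and
  properly discontinuously on `ℍ`, there is a holomorphic `F : ℍ → ℂ` with `‖F‖ < 1`, `F (q • τ) = F τ` for
  all `q ∈ Λ̄`, and `F` not constant** (trichotomy of a non-trivial element: elliptic is excluded by freeness
  (`psl_mk_eq_one_of_isElliptic_of_mem`), parabolic ⇒ §1, hyperbolic ⇒ §2; `Λ̄ = 1` ⇒ any cusp function).

Consumed by `…PSLCompactGenuineHyperbolic` (a COMPACT Riemann surface uniformised by `ℍ` has non-abelian `π₁`: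
`F` would descend to a non-constant holomorphic function on the compact quotient).  PROOF-ONLY (no
definition, no instance, no named fact); classical; MODEL side of [AbsTopIII] §2/§4; nothing here bears on the
disputed [IUTchIII] Cor. 3.12.

## References
* H. M. Farkas, I. Kra, *Riemann Surfaces*, 2nd ed. (1992), IV.5.6, IV.6. [FarkasKra1992]
* A. F. Beardon, *The Geometry of Discrete Groups*, GTM 91 (1983), §4.3. [Beardon1983]
* S. Mochizuki, *Topics in Absolute Anabelian Geometry III* (2015), Cor. 2.4 p.54, Prop. 4.2 (i) p.106.
  [MochizukiAbsTopIII2015]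
-/

set_option autoImplicit false

noncomputable section

open Complex Filter Topology Set Function
open scoped UpperHalfPlane MatrixGroups Matrix Manifold ContDiff Real
open Literature.NumberTheory.Automorphic.Fuchsian (translSL translSL_apply_00 translSL_apply_01
  translSL_apply_10 translSL_apply_11 coe_diag_smul)

namespace Literature.AnabelianGeometry.AbsoluteAnabelian

namespace HolRS

/-! ### §0 The one-parameter group of translations -/

/-- `T_0 = 1`. [folklore] -/
private theorem translSL_zero : translSL 0 = 1 := by
  ext i j
  fin_cases i <;> fin_cases j <;> simp [translSL_apply_00, translSL_apply_01, translSL_apply_10, translSL_apply_11]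

/-- `T_{a+b} = T_a T_b`. [folklore] -/
private theorem translSL_add (a b : ℝ) : translSL (a + b) = translSL a * translSL b := by
  ext i j
  fin_cases i <;> fin_cases j <;>
    simp [Matrix.SpecialLinearGroup.coe_mul, Matrix.mul_apply, Fin.sum_univ_two, translSL_apply_00,
      translSL_apply_01, translSL_apply_10, translSL_apply_11, add_comm]

/-- `T_{-a} = T_a⁻¹`. [folklore] -/
private theorem translSL_neg (a : ℝ) : translSL (-a) = (translSL a)⁻¹ := by
  rw [eq_inv_iff_mul_eq_one, ← translSL_add, neg_add_cancel, translSL_zero]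

/-- `T_{n b} = T_b ^ n`. [folklore] -/
private theorem translSL_zsmul (n : ℤ) (b : ℝ) : translSL (n • b) = translSL b ^ n := by
  induction n using Int.induction_on with
  | zero => rw [zero_zsmul, translSL_zero, zpow_zero]
  | succ n ih => rw [add_zsmul, one_zsmul, translSL_add, ih, zpow_add_one]
  | pred n ih => rw [sub_zsmul, one_zsmul, zpow_sub_one, ← ih, ← translSL_neg, ← translSL_add]

/-- The translation `T_y` moves `i` to `i + y`. [folklore] -/
private theorem coe_translSL_smul_I (y : ℝ) : (((translSL y) • UpperHalfPlane.I : ℍ) : ℂ) = I + y := by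
  rw [coe_translSL_smul', UpperHalfPlane.coe_I]

/-- The generator of a cyclic subgroup containing a non-zero element is non-zero. [folklore] -/
private theorem generator_ne_zero {Y : AddSubgroup ℝ} {b y : ℝ} (hY : Y = AddSubgroup.closure {b}) (hy : y ∈ Y)
    (hy0 : y ≠ 0) : b ≠ 0 := by
  rintro rfl
  rw [hY, AddSubgroup.mem_closure_singleton] at hy
  obtain ⟨n, rfl⟩ := hy
  simp at hy0

/-! ### §1 The parabolic case: translation lengths at a cusp -/

/-- **A central parabolic element makes `Λ̄` invariant-integrable at its cusp.**  Let `Λ̄ ≤ PSL₂(ℝ)` act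
properly discontinuously on `ℍ` and contain the parabolic `π(A T_h A⁻¹)`, `h ≠ 0`, commuting with every
element of `Λ̄`.  Then there is a holomorphic `F : ℍ → ℂ` with `‖F τ‖ < 1`, `F (q • τ) = F τ` for all
`q ∈ Λ̄`, and `F` not constant.  (Every `q ∈ Λ̄` is a translation `π(A T_y A⁻¹)` at the same cusp
(`exists_eq_conj_translSL_of_commute`); the lengths `y` form a subgroup of `ℝ`, cyclic by proper
discontinuity (`exists_eq_closure_of_smul_curve`), `= ℤ b`, `b ≠ 0`; take the cusp function of `A T_{|b|} A⁻¹`.)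
[cite: FarkasKra1992, IV.6] [cite: Beardon1983, §4.3] -/
theorem exists_invariant_of_translSL_mem (Λ : Subgroup PSL2R) [ProperlyDiscontinuousSMul Λ ℍ]
    {A : SL(2, ℝ)} {h : ℝ} (hh : h ≠ 0)
    (hγ : (QuotientGroup.mk' (Subgroup.center SL(2, ℝ)) (A * translSL h * A⁻¹) : PSL2R) ∈ Λ)
    (hc : ∀ q ∈ Λ, q * QuotientGroup.mk' (Subgroup.center SL(2, ℝ)) (A * translSL h * A⁻¹) =
      QuotientGroup.mk' (Subgroup.center SL(2, ℝ)) (A * translSL h * A⁻¹) * q) :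
    ∃ F : ℍ → ℂ, MDifferentiable 𝓘(ℂ, ℂ) 𝓘(ℂ, ℂ) F ∧ (∀ τ, ‖F τ‖ < 1) ∧
      (∀ q : Λ, ∀ τ : ℍ, F (q • τ) = F τ) ∧ ∃ τ₁ τ₂, F τ₁ ≠ F τ₂ := by
  set pr : SL(2, ℝ) →* PSL2R := QuotientGroup.mk' (Subgroup.center SL(2, ℝ)) with hpr
  have hconj : ∀ z : ℝ, pr (A * translSL z * A⁻¹) = pr A * pr (translSL z) * (pr A)⁻¹ := fun z => by
    rw [map_mul, map_mul, map_inv]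
  -- the subgroup of translation lengths of `Λ̄` at the cusp `A • ∞`
  let Y : AddSubgroup ℝ :=
    { carrier := {y | pr (A * translSL y * A⁻¹) ∈ Λ}
      zero_mem' := by
        show pr (A * translSL 0 * A⁻¹) ∈ Λ
        rw [translSL_zero, mul_one, mul_inv_cancel, map_one]
        exact Λ.one_mem
      add_mem' := fun {a b} ha hb => by
        show pr (A * translSL (a + b) * A⁻¹) ∈ Λ
        have : A * translSL (a + b) * A⁻¹ = (A * translSL a * A⁻¹) * (A * translSL b * A⁻¹) := by
          rw [translSL_add]; group
        rw [this, map_mul]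
        exact Λ.mul_mem ha hb
      neg_mem' := fun {a} ha => by
        show pr (A * translSL (-a) * A⁻¹) ∈ Λ
        have : A * translSL (-a) * A⁻¹ = (A * translSL a * A⁻¹)⁻¹ := by
          rw [translSL_neg]; group
        rw [this, map_inv]
        exact Λ.inv_mem ha }
  have hYmem : ∀ y : ℝ, y ∈ Y ↔ pr (A * translSL y * A⁻¹) ∈ Λ := fun y => Iff.rfl
  -- the horocyclic curve `y ↦ A • (i + y)` through the orbit
  set c : ℝ → ℍ := fun y => A • ((translSL y) • UpperHalfPlane.I) with hcdef
  have hcont : Continuous c := by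
    refine (continuous_const_smul A).comp ?_
    refine UpperHalfPlane.isEmbedding_coe.isInducing.continuous_iff.mpr ?_
    have : (UpperHalfPlane.coe ∘ fun y : ℝ => (translSL y) • UpperHalfPlane.I) = fun y : ℝ => I + (y : ℂ) :=
      funext fun y => coe_translSL_smul_I y
    rw [this]
    exact continuous_const.add continuous_ofReal
  have hinj : Injective c := by
    intro y y' hyy'
    have h1 : ((translSL y) • UpperHalfPlane.I : ℍ) = (translSL y') • UpperHalfPlane.I := smul_left_cancel A hyy'
    have h2 := congrArg UpperHalfPlane.coe h1
    rw [coe_translSL_smul_I, coe_translSL_smul_I, add_right_inj] at h2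
    exact_mod_cast h2
  have hY : ∀ y ∈ Y, ∃ q : Λ, q • c 0 = c y := by
    intro y hy
    refine ⟨⟨pr (A * translSL y * A⁻¹), hy⟩, ?_⟩
    show (pr (A * translSL y * A⁻¹) : PSL2R) • (A • ((translSL 0) • UpperHalfPlane.I)) =
      A • ((translSL y) • UpperHalfPlane.I)
    rw [translSL_zero, one_smul, hpr, QuotientGroup.mk'_apply, psl_mk_smul, mul_smul, mul_smul,
      inv_smul_smul]
  -- the lengths form a cyclic group `ℤ b`, `b ≠ 0`
  obtain ⟨b, hYb⟩ := exists_eq_closure_of_smul_curve Y c hcont hinj hY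
  have hb : b ≠ 0 := generator_ne_zero hYb ((hYmem h).mpr hγ) hh
  have hx : 0 < |b| := abs_pos.mpr hb
  -- the cusp function of the generator
  obtain ⟨F, hF, hFb, hFinv, hne⟩ := exists_cuspFunction A hx
  refine ⟨F, hF, hFb, fun q τ => ?_, hne⟩
  -- `q` is a translation at the same cusp, by a multiple of `b`
  obtain ⟨y, hy⟩ := exists_eq_conj_translSL_of_commute hh (hc q q.2)
  rw [← hpr] at hy
  have hyY : y ∈ Y := by
    rw [hYmem, hconj, ← hy]
    exact q.2
  rw [hYb, AddSubgroup.mem_closure_singleton] at hyY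
  obtain ⟨n, rfl⟩ := hyY
  -- hence a power of `π(A T_{|b|} A⁻¹)`, under which `F` is invariant
  have hγF : ∀ τ : ℍ, F ((pr (A * translSL |b| * A⁻¹) : PSL2R) • τ) = F τ := fun τ => by
    rw [hpr, QuotientGroup.mk'_apply, psl_mk_smul]
    exact hFinv τ
  have key : ∀ m : ℤ, pr (A * translSL |b| * A⁻¹) ^ m = pr A * pr (translSL (m • |b|)) * (pr A)⁻¹ :=
    fun m => by rw [← map_zpow, conj_zpow, map_mul, map_mul, map_inv, translSL_zsmul]
  have hmem : (q : PSL2R) ∈ Subgroup.zpowers (pr (A * translSL |b| * A⁻¹)) := by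
    rcases abs_choice b with hab | hab
    · refine Subgroup.mem_zpowers_iff.mpr ⟨n, ?_⟩
      rw [key, hy, hab]
    · refine Subgroup.mem_zpowers_iff.mpr ⟨-n, ?_⟩
      rw [key, hy, show (-n) • |b| = n • b by rw [hab, zsmul_eq_mul, zsmul_eq_mul]; push_cast; ring]
  exact forall_mem_zpowers_smul_eq hγF (q : PSL2R) hmem τ

/-! ### §2 The hyperbolic case: dilation factors along an axis -/

/-- **A central hyperbolic element makes `Λ̄` invariant-integrable along its axis.**  Let `Λ̄ ≤ PSL₂(ℝ)`
act properly discontinuously on `ℍ` and contain the hyperbolic `π(g D g⁻¹)`, `D = diag(l, l⁻¹)`, `l² ≠ 1`,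
commuting with every element of `Λ̄`.  Then there is a holomorphic `F : ℍ → ℂ` with `‖F τ‖ < 1`,
`F (q • τ) = F τ` for all `q ∈ Λ̄`, and `F` not constant.  (Every `q ∈ Λ̄` is `π(g E g⁻¹)` with `E` diagonal
(`exists_eq_conj_diag_of_commute`), a dilation by `e^{y}` in the frame `g`; the `y` form a subgroup of `ℝ`,
cyclic by proper discontinuity, `= ℤ b`, `b ≠ 0`; take the axis function with `ℓ = |b|`.)
[cite: FarkasKra1992, IV.6] [cite: Beardon1983, §4.3] -/
theorem exists_invariant_of_diag_mem (Λ : Subgroup PSL2R) [ProperlyDiscontinuousSMul Λ ℍ]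
    {g D : SL(2, ℝ)} (h01 : D 0 1 = 0) (h10 : D 1 0 = 0) (hl : D 0 0 ^ 2 ≠ 1)
    (hγ : (QuotientGroup.mk' (Subgroup.center SL(2, ℝ)) (g * D * g⁻¹) : PSL2R) ∈ Λ)
    (hc : ∀ q ∈ Λ, q * QuotientGroup.mk' (Subgroup.center SL(2, ℝ)) (g * D * g⁻¹) =
      QuotientGroup.mk' (Subgroup.center SL(2, ℝ)) (g * D * g⁻¹) * q) :
    ∃ F : ℍ → ℂ, MDifferentiable 𝓘(ℂ, ℂ) 𝓘(ℂ, ℂ) F ∧ (∀ τ, ‖F τ‖ < 1) ∧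
      (∀ q : Λ, ∀ τ : ℍ, F (q • τ) = F τ) ∧ ∃ τ₁ τ₂, F τ₁ ≠ F τ₂ := by
  have hexp0 : ∀ a : ℝ, ((Real.exp a : ℝ) : ℂ) ≠ 0 := fun a => ofReal_ne_zero.mpr (Real.exp_pos a).ne'
  -- the subgroup of logarithmic dilation factors of `Λ̄` along the axis `g • iℝ₊`
  let Y : AddSubgroup ℝ :=
    { carrier := {y | ∃ q ∈ Λ, ∀ τ : ℍ, ((g⁻¹ • (q • (g • τ)) : ℍ) : ℂ) = Real.exp y * (τ : ℂ)}
      zero_mem' := ⟨1, Λ.one_mem, fun τ => by rw [one_smul, inv_smul_smul, Real.exp_zero, ofReal_one, one_mul]⟩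
      add_mem' := by
        rintro a a' ⟨p, hp, hpa⟩ ⟨q, hq, hqa⟩
        refine ⟨p * q, Λ.mul_mem hp hq, fun τ => ?_⟩
        have : (g⁻¹ • ((p * q) • (g • τ)) : ℍ) = g⁻¹ • (p • (g • (g⁻¹ • (q • (g • τ))))) := by
          rw [mul_smul, smul_inv_smul]
        rw [this, hpa, hqa, Real.exp_add, ofReal_mul, mul_assoc]
      neg_mem' := by
        rintro a ⟨p, hp, hpa⟩
        refine ⟨p⁻¹, Λ.inv_mem hp, fun τ => ?_⟩
        have key := hpa (g⁻¹ • (p⁻¹ • (g • τ)))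
        rw [smul_inv_smul, smul_inv_smul, inv_smul_smul] at key
        rw [Real.exp_neg, ofReal_inv, key, inv_mul_cancel_left₀ (hexp0 a)] }
  have hYmem : ∀ y : ℝ, y ∈ Y ↔
      ∃ q ∈ Λ, ∀ τ : ℍ, ((g⁻¹ • (q • (g • τ)) : ℍ) : ℂ) = Real.exp y * (τ : ℂ) := fun y => Iff.rfl
  -- the axis `y ↦ g • (e^y i)` through the orbit
  set c : ℝ → ℍ := fun y => g • UpperHalfPlane.mk (Real.exp y * I) (by rw [mul_I_im, ofReal_re]; exact Real.exp_pos y) with hcdef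
  have hcoe : ∀ y : ℝ, ((UpperHalfPlane.mk (Real.exp y * I) (by rw [mul_I_im, ofReal_re]; exact Real.exp_pos y) : ℍ) : ℂ) =
      Real.exp y * I := fun y => rfl
  have hcont : Continuous c := by
    refine (continuous_const_smul g).comp ?_
    refine UpperHalfPlane.isEmbedding_coe.isInducing.continuous_iff.mpr ?_
    exact (continuous_ofReal.comp Real.continuous_exp).mul continuous_const
  have hinj : Injective c := by
    intro y y' hyy'
    have h1 := congrArg UpperHalfPlane.coe (smul_left_cancel g hyy')
    rw [hcoe, hcoe, mul_left_inj' I_ne_zero] at h1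
    exact Real.exp_injective (by exact_mod_cast h1)
  have hY : ∀ y ∈ Y, ∃ q : Λ, q • c 0 = c y := by
    rintro y ⟨q, hq, hqy⟩
    refine ⟨⟨q, hq⟩, ?_⟩
    show (q : PSL2R) • (g • UpperHalfPlane.mk (Real.exp 0 * I) _) = g • UpperHalfPlane.mk (Real.exp y * I) _
    rw [← inv_smul_eq_iff]
    refine UpperHalfPlane.ext ?_
    rw [hqy, hcoe, hcoe, Real.exp_zero, ofReal_one, one_mul]
  -- the factors form a cyclic group `ℤ b`, `b ≠ 0` (the generator `π(g D g⁻¹)` dilates by `l² ≠ 1`)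
  obtain ⟨b, hYb⟩ := exists_eq_closure_of_smul_curve Y c hcont hinj hY
  have hDY : Real.log (D 0 0 ^ 2) ∈ Y :=
    ⟨_, hγ, fun τ => by rw [coe_conj_diag_smul h01 h10, Real.exp_log (diag_sq_pos h01)]⟩
  have hb : b ≠ 0 :=
    generator_ne_zero hYb hDY (Real.log_ne_zero_of_pos_of_ne_one (diag_sq_pos h01) hl)
  have hℓ : 0 < |b| := abs_pos.mpr hb
  -- the axis function of the generator
  obtain ⟨F, hF, hFb, hFinv, hne⟩ := exists_axisFunction g hℓ
  refine ⟨F, hF, hFb, fun q τ => ?_, hne⟩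
  -- `q` is a dilation along the same axis, by `e^{n b}`
  obtain ⟨E, hE01, hE10, hqE⟩ := exists_eq_conj_diag_of_commute h01 h10 hl (hc q q.2)
  have hq : ∀ σ : ℍ, ((g⁻¹ • ((q : PSL2R) • (g • σ)) : ℍ) : ℂ) = Real.exp (Real.log (E 0 0 ^ 2)) * (σ : ℂ) :=
    fun σ => by rw [hqE, coe_conj_diag_smul hE01 hE10, Real.exp_log (diag_sq_pos hE01)]
  have hyY : Real.log (E 0 0 ^ 2) ∈ Y := ⟨_, q.2, hq⟩
  rw [hYb, AddSubgroup.mem_closure_singleton] at hyY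
  obtain ⟨n, hn⟩ := hyY
  rcases abs_choice b with hab | hab
  · refine hFinv (q : PSL2R) n (fun σ => ?_) τ
    rw [hq σ, ← hn, hab, zsmul_eq_mul]
  · refine hFinv (q : PSL2R) (-n) (fun σ => ?_) τ
    rw [hq σ, ← hn, zsmul_eq_mul, show (n : ℝ) * b = ((-n : ℤ) : ℝ) * |b| by rw [hab]; push_cast; ring]

/-! ### §3 Assembly: abelian, free, properly discontinuous -/

/-- ★ **An abelian torsion-free Fuchsian group admits a bounded invariant non-constant holomorphic
function.**  For `Λ̄ ≤ PSL₂(ℝ)` ABELIAN, acting on `ℍ` properly discontinuously and freely, there is a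
holomorphic `F : ℍ → ℂ` with `‖F τ‖ < 1`, `F (q • τ) = F τ` for every `q ∈ Λ̄`, and `F τ₁ ≠ F τ₂` for some
`τ₁, τ₂`.  Proof: if `Λ̄ = 1` take any cusp function; otherwise pick `γ = π(G) ≠ 1` in `Λ̄`: `(tr G)² < 4` is
impossible (an elliptic element fixes a point, contradicting freeness), `(tr G)² = 4` makes `γ` parabolic
(§1), `(tr G)² > 4` hyperbolic (§2, via `Fuchsian.exists_conj_diag`).  (Classically: `Λ̄` is cyclic and `ℍ/Λ̄`
is `ℍ`, a punctured disc or an annulus, none compact.) [cite: FarkasKra1992, IV.6] [cite: Beardon1983, §4.3] -/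
theorem exists_invariant_holomorphic_of_comm (Λ : Subgroup PSL2R) [ProperlyDiscontinuousSMul Λ ℍ]
    [IsCancelSMul Λ ℍ] (hcomm : ∀ p q : Λ, p * q = q * p) :
    ∃ F : ℍ → ℂ, MDifferentiable 𝓘(ℂ, ℂ) 𝓘(ℂ, ℂ) F ∧ (∀ τ, ‖F τ‖ < 1) ∧
      (∀ q : Λ, ∀ τ : ℍ, F (q • τ) = F τ) ∧ ∃ τ₁ τ₂, F τ₁ ≠ F τ₂ := by
  by_cases hbot : ∀ q : Λ, q = 1
  · obtain ⟨F, hF, hFb, -, hne⟩ := exists_cuspFunction 1 one_pos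
    exact ⟨F, hF, hFb, fun q τ => by rw [hbot q, one_smul], hne⟩
  push Not at hbot
  obtain ⟨γ, hγ1⟩ := hbot
  obtain ⟨G, hG⟩ := QuotientGroup.mk'_surjective (Subgroup.center SL(2, ℝ)) (γ : PSL2R)
  have hGΛ : (QuotientGroup.mk' (Subgroup.center SL(2, ℝ)) G : PSL2R) ∈ Λ := by
    rw [hG]; exact γ.2
  have hG1 : (QuotientGroup.mk' (Subgroup.center SL(2, ℝ)) G : PSL2R) ≠ 1 := by
    rw [hG]
    exact fun h => hγ1 (Subtype.ext h)
  have hcG : ∀ q ∈ Λ, q * QuotientGroup.mk' (Subgroup.center SL(2, ℝ)) G =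
      QuotientGroup.mk' (Subgroup.center SL(2, ℝ)) G * q := fun q hq => by
    rw [hG]
    exact congrArg Subtype.val (hcomm ⟨q, hq⟩ γ)
  rcases lt_trichotomy ((G 0 0 + G 1 1) ^ 2) 4 with hlt | heq | hgt
  · -- elliptic: excluded by freeness
    exfalso
    refine hG1 (psl_mk_eq_one_of_isElliptic_of_mem Λ ?_ hGΛ)
    show (G : Matrix (Fin 2) (Fin 2) ℝ).discr < 0
    rw [discr_coe_sl]
    linarith
  · -- parabolic
    obtain ⟨A, h, hh, hAt⟩ := exists_psl_conj_translSL_eq (isParabolic_of_sq_trace_eq_four heq hG1)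
    rw [← hAt] at hGΛ hcG
    exact exists_invariant_of_translSL_mem Λ hh hGΛ hcG
  · -- hyperbolic
    obtain ⟨g, h01, h10, hl⟩ := Literature.NumberTheory.Automorphic.Fuchsian.exists_conj_diag G hgt
    have hGeq : G = g * (g⁻¹ * G * g) * g⁻¹ := by group
    rw [hGeq] at hGΛ hcG
    exact exists_invariant_of_diag_mem Λ h01 h10 hl hGΛ hcG

end HolRS

end Literature.AnabelianGeometry.AbsoluteAnabelian

end
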